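/-
Cell pub-hodgecm2 (COR-CM = stage 2 of the Hodge ladder), seat p2 (binder prover 2/8), gen 22
(prover-pub-hodgecm2-p2-g22-0), 2026-08-21.  Count-neutral own lane PERL-WEIL-LINE (work item W-a of
`hodge-director/B01-SIZE.md` §4 T2), file F6a: PerL's type data from ANY four inequivalent CM types of a sextic
field.  Pure CM-type combinatorics; theorems only; HC_CM is NOT proved.
-/
import Summits.HodgeConjecture.CorCM.SexticCMFourTypesSignRelation
import Summits.HodgeConjecture.CorCM.StubTree.Combinatorics
import Literature.NumberTheory.Automorphic.IdeleClassCharacterConjugate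
import HarnessLib

/-!
# Any four pairwise inequivalent CM types of a sextic CM field are a PerL quadruple, up to order and conjugation

`Universe.PerL` (`CorCM/Geometry/Statements.lean`) quantifies over a FRAME `φ : Fin 3 → (K → ℂ)` of the sextic CM
field `K` (`IsFrame`: three embeddings at the three places) and a quadruple `t : Fin 4 → CMType K` with the sign
table `perlSign` relative to `φ` (`IsPerLTypes φ t`: `t⁰ = (+,+,+)`, `t¹ = (+,−,−)`, `t² = (+,−,+)`, `t³ = (+,+,−)`,
i.e. the four CM types containing `φ 0`).  A sextic CM field has `2³ = 8` CM types, i.e. FOUR up to complex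
conjugation; so EVERY quadruple `τ` of pairwise inequivalent types (`τ_j ∉ {τ_i, τ̄_i}` for `i ≠ j` — e.g. the types
of four pairwise non-isogenous CM abelian threefolds with CM by `K`, `GenericCMField.antiVec_ne_of_not_isIsogenous`)
becomes a PerL quadruple after reordering and replacing some `τ_i` by `τ̄_i`:

* **`exists_isFrame_isPerLTypes_of_four_types`** — `∃ φ (π : Equiv.Perm (Fin 4)) (ε : Fin 4 → Bool) t, IsFrame φ ∧
  IsPerLTypes φ t ∧ ∀ k, t k = if ε k then bar (τ (π k)) else τ (π k)`.  Construction: `φ` enumerates `τ 0`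
  (three embeddings at three distinct places; every embedding is some `φ_k` or `φ̄_k`); flip each `τ_i` not
  containing `φ 0`; a type containing `φ 0` is determined by its signs at `φ 1, φ 2`, the four normalised types
  are pairwise distinct, so their sign map is a bijection onto `Bool × Bool`, and `π` matches it with the sign
  table.
* `exists_ringHom_comp_eq` — every embedding `φ 0 : K → ℂ` extends along `j : K → L` to `ι₁ : L → ℂ`
  (`ℂ` algebraically closed); so the remaining PerL data `(ι₁, hι)` exist for any `j`.

Used by `CorCM/PerLWeilLineFourTypes.lean` to state PerL's Hodge-theoretic consequence for ANY four CM threefolds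
of pairwise inequivalent types (no frame / sign-table bookkeeping in the hypotheses).
References: PerL v5 §1 (sign table), rfwf v3 §4.2; Shimura 1998 §8.4 (CM types of a field); `CorCM/CM/Basic.lean`.
-/

noncomputable section

namespace Summit.HodgeConjecture.CorCM.PerLTypes

open NumberField NumberField.ComplexEmbedding NumberField.InfinitePlace
open Literature.AlgebraicGeometry.Motives (CMType)
open Literature.NumberTheory.ComplexMultiplication.CMTypeOps

/-- Every complex embedding of `K` extends along a ring homomorphism `j : K → L` of number fields
(`L/j(K)` algebraic, `ℂ` algebraically closed). [folklore] -/
theorem exists_ringHom_comp_eq (K L : CMField) (j : K →+* L) (φ₀ : K →+* ℂ) :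
    ∃ ι₁ : L →+* ℂ, ι₁.comp j = φ₀ := by
  letI : Algebra K L := j.toAlgebra
  letI : Algebra K ℂ := φ₀.toAlgebra
  haveI : IsScalarTower ℚ K L := IsScalarTower.of_algebraMap_eq fun x => (map_ratCast j x).symm
  haveI : Algebra.IsAlgebraic K L := Algebra.IsAlgebraic.tower_top (K := ℚ) K
  let ψ : L →ₐ[K] ℂ := IsAlgClosed.lift
  exact ⟨ψ.toRingHom, ψ.comp_algebraMap⟩

/-- Two elements of one CM type at the same infinite place are equal (a CM type never contains a conjugate pair).
[folklore] -/
theorem eq_of_mem_cmType_of_mk_eq {K : Type} [Field K] (Φ : CMType K) {a b : K →+* ℂ} (ha : a ∈ Φ.1)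
    (hb : b ∈ Φ.1) (h : InfinitePlace.mk a = InfinitePlace.mk b) : a = b := by
  rcases InfinitePlace.mk_eq_iff.1 h with h | h
  · exact h
  · exact absurd (h ▸ hb) ((mem_iff_conjugate_notMem Φ a).1 ha)

/-- In a sextic CM field, a frame exhausts the embeddings: every `ψ : K → ℂ` is some `φ_k` or `φ̄_k`. [folklore] -/
theorem exists_eq_or_eq_conjugate_of_isFrame (K : CMField) (h6 : Module.finrank ℚ K = 6)
    (φ : Fin 3 → (K →+* ℂ)) (hφ : IsFrame φ) (ψ : K →+* ℂ) : ∃ k, ψ = φ k ∨ ψ = conjugate (φ k) := by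
  classical
  have hcard : Fintype.card (InfinitePlace K) = 3 := by
    have h1 := InfinitePlace.card_eq_nrRealPlaces_add_nrComplexPlaces (K := K)
    have h2 := IsTotallyComplex.finrank (K := K)
    have h3 := IsTotallyComplex.nrRealPlaces_eq_zero (K := K)
    omega
  have hinj : Function.Injective (fun j => InfinitePlace.mk (φ j)) := fun j j' h => by
    by_contra hne; exact hφ j j' hne h
  have hsurj : Function.Surjective (fun j => InfinitePlace.mk (φ j)) :=
    ((Fintype.bijective_iff_injective_and_card _).mpr ⟨hinj, by simp [hcard]⟩).2
  obtain ⟨k, hk⟩ := hsurj (InfinitePlace.mk ψ)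
  rcases InfinitePlace.mk_eq_iff.1 hk with h | h
  · exact ⟨k, Or.inl h.symm⟩
  · exact ⟨k, Or.inr h.symm⟩

/-- **Every quadruple of pairwise inequivalent CM types of a sextic CM field is a PerL quadruple up to order and
conjugation.**  For `[K:ℚ] = 6` and `τ : Fin 4 → CMType K` with `τ_j ≠ τ_i`, `τ_j ≠ τ̄_i` (`i ≠ j`) there are a frame
`φ`, a permutation `π` of the four indices, flips `ε` and a PerL quadruple `t` for `φ` (`IsPerLTypes φ t`) with
`t_k = τ_{π k}` or `τ̄_{π k}` according to `ε k`. [folklore] -/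
theorem exists_isFrame_isPerLTypes_of_four_types (K : CMField) (h6 : Module.finrank ℚ K = 6)
    (τ : Fin 4 → CMType K) (hτ : ∀ i j, i ≠ j → τ j ≠ τ i ∧ τ j ≠ bar (τ i)) :
    ∃ (φ : Fin 3 → (K →+* ℂ)) (π : Equiv.Perm (Fin 4)) (ε : Fin 4 → Bool) (t : Fin 4 → CMType K),
      IsFrame φ ∧ IsPerLTypes φ t ∧ ∀ k, t k = if ε k then bar (τ (π k)) else τ (π k) := by
  classical
  -- (1) a frame enumerating the type `τ 0`
  have h3 : (τ 0).1.ncard = 3 := by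
    have := GenericCMField.two_mul_ncard_cmType (τ 0); omega
  obtain ⟨x, y, z, hxy, hxz, hyz, h0⟩ := Set.ncard_eq_three.1 h3
  let φ : Fin 3 → (K →+* ℂ) := ![x, y, z]
  have hφmem : ∀ j, φ j ∈ (τ 0).1 := by
    intro j; fin_cases j <;> simp [φ, h0]
  have hφinj : Function.Injective φ := by
    intro j j' h
    fin_cases j <;> fin_cases j' <;> simp_all [φ]
  have hframe : IsFrame φ := fun j j' hne heq =>
    hne (hφinj (eq_of_mem_cmType_of_mk_eq (τ 0) (hφmem j) (hφmem j') heq))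
  have hcover := exists_eq_or_eq_conjugate_of_isFrame K h6 φ hframe
  -- (2) normalise: every type is replaced, if necessary, by its conjugate so as to contain `φ 0`
  let ε₀ : Fin 4 → Bool := fun i => decide (φ 0 ∉ (τ i).1)
  let σ : Fin 4 → CMType K := fun i => if ε₀ i then bar (τ i) else τ i
  have hσ0 : ∀ i, φ 0 ∈ (σ i).1 := by
    intro i
    by_cases h : φ 0 ∈ (τ i).1
    · simp [σ, ε₀, h]
    · simp [σ, ε₀, h, mem_bar_iff]
  -- (3) a type containing `φ 0` is determined by its signs at `φ 1`, `φ 2`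
  have hdet : ∀ i i', (φ 1 ∈ (σ i).1 ↔ φ 1 ∈ (σ i').1) → (φ 2 ∈ (σ i).1 ↔ φ 2 ∈ (σ i').1) →
      σ i = σ i' := by
    intro i i' h1 h2
    have hk : ∀ k, (φ k ∈ (σ i).1 ↔ φ k ∈ (σ i').1) := fun k =>
      match k with
      | 0 => iff_of_true (hσ0 i) (hσ0 i')
      | 1 => h1
      | 2 => h2
    apply Subtype.ext
    ext ψ
    obtain ⟨k, hψ | hψ⟩ := hcover ψ
    · rw [hψ]; exact hk k
    · rw [hψ, conjugate_mem_iff_notMem, conjugate_mem_iff_notMem]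
      exact not_congr (hk k)
  -- (4) the normalised types are pairwise distinct
  have hσinj : Function.Injective σ := by
    intro i i' h
    by_contra hne
    obtain ⟨hne₁, hne₂⟩ := hτ i i' hne
    simp only [σ] at h
    split_ifs at h with hi hi' hi'
    · exact hne₁ (bar_injective h).symm
    · exact hne₂ h.symm
    · exact hne₂ (by rw [h, bar_bar])
    · exact hne₁ h.symm
  -- (5) the sign map is a bijection onto `Bool × Bool`; match it with the PerL sign table
  let sg : Fin 4 → Bool × Bool := fun i => (decide (φ 1 ∈ (σ i).1), decide (φ 2 ∈ (σ i).1))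
  have hsg : Function.Injective sg := by
    intro i i' h
    simp only [sg, Prod.mk.injEq, decide_eq_decide] at h
    exact hσinj (hdet i i' h.1 h.2)
  have hsgb : Function.Bijective sg := (Fintype.bijective_iff_injective_and_card sg).2 ⟨hsg, by simp⟩
  let e : Fin 4 ≃ Bool × Bool := Equiv.ofBijective sg hsgb
  let labf : Fin 4 → Bool × Bool := fun k => (perlSign k 1, perlSign k 2)
  have hlabf : Function.Bijective labf :=
    (Fintype.bijective_iff_injective_and_card labf).2 ⟨by decide, by simp⟩
  let lab : Fin 4 ≃ Bool × Bool := Equiv.ofBijective labf hlabf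
  let π : Equiv.Perm (Fin 4) := lab.trans e.symm
  have hπ : ∀ k, sg (π k) = labf k := fun k => by
    show e (e.symm (lab k)) = lab k
    simp
  refine ⟨φ, π, fun k => ε₀ (π k), fun k => σ (π k), hframe, ?_, fun k => rfl⟩
  -- (6) the PerL sign table
  intro k jx
  fin_cases jx
  · show φ 0 ∈ (σ (π k)).1 ↔ perlSign k 0 = true
    exact iff_of_true (hσ0 _) (by fin_cases k <;> rfl)
  · show φ 1 ∈ (σ (π k)).1 ↔ perlSign k 1 = true
    have h := congrArg Prod.fst (hπ k)
    simp only [sg, labf] at h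
    rw [← h]
    exact (Bool.decide_iff _).symm
  · show φ 2 ∈ (σ (π k)).1 ↔ perlSign k 2 = true
    have h := congrArg Prod.snd (hπ k)
    simp only [sg, labf] at h
    rw [← h]
    exact (Bool.decide_iff _).symm

/-- Packaged with the embedding extension: for a sextic CM field with ANY normal-closure map `j : K → L` and four
pairwise inequivalent types, ALL the type data of `Universe.PerL` exist — frame `φ`, `ι₁ : L → ℂ` over `φ 0`, and a
PerL quadruple that is `τ` up to order and conjugation. [folklore] -/
theorem exists_perLData_of_four_types (K L : CMField) (j : K →+* L) (h6 : Module.finrank ℚ K = 6)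
    (τ : Fin 4 → CMType K) (hτ : ∀ i j, i ≠ j → τ j ≠ τ i ∧ τ j ≠ bar (τ i)) :
    ∃ (φ : Fin 3 → (K →+* ℂ)) (ι₁ : L →+* ℂ) (π : Equiv.Perm (Fin 4)) (ε : Fin 4 → Bool)
      (t : Fin 4 → CMType K),
      IsFrame φ ∧ ι₁.comp j = φ 0 ∧ IsPerLTypes φ t ∧ ∀ k, t k = if ε k then bar (τ (π k)) else τ (π k) := by
  obtain ⟨φ, π, ε, t, hφ, ht, hτt⟩ := exists_isFrame_isPerLTypes_of_four_types K h6 τ hτ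
  obtain ⟨ι₁, hι⟩ := exists_ringHom_comp_eq K L j (φ 0)
  exact ⟨φ, ι₁, π, ε, t, hφ, hι, ht, hτt⟩

end Summit.HodgeConjecture.CorCM.PerLTypes

end
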